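import Summits.PneNP.PneNP.Theses.DescentTower

/-!
# Route DescentTower — `LevelsSound` (stmt-PneNP-2542)

Definition sanity for the inline renderings of the Lasserre / cohomological-consistency levels: a 3-colourable graph is
accepted by every level. Take the genuine expectation `E = evaluation at the 0/1 point of a proper colouring c`
(`x_{3v+a} ↦ [c v = a]`; a pseudoexpectation of every degree satisfying Booleanity, the "one colour per vertex" and the
edge identities), the family `H = {(U, c|_U) : |U| ≤ k}` of restrictions of `c`, and the `ℤ`-sections
`r_U = indicator of c|_U` (which marginalise correctly because restriction commutes with further restriction).
-/

set_option linter.dupNamespace false -- `Summit.PneNP.PneNP.…`: summit = sub-problem name (D-0017 single-conjunct layout)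

namespace Summit.PneNP.PneNP.Theorems

open MvPolynomial Finset

/-- **Marginalisation of indicator sections**: with `c_U := (v ↦ if v ∈ U then c v else 0)` and
`r U t := [|U| ≤ k ∧ t = c_U]`, for `D ⊆ U`, `|U| ≤ k`: `r D t' = Σ_t [t' = t|_D] · r U t`. [folklore] -/
theorem descentTower_indicator_marginal {n : ℕ} (k : ℕ) (c : Fin n → Fin 3) (U D : Finset (Fin n)) (hDU : D ⊆ U)
    (hU : U.card ≤ k) (t' : Fin n → Fin 3) :
    (if D.card ≤ k ∧ t' = (fun v => if v ∈ D then c v else 0) then (1 : ℤ) else 0) =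
      ∑ t : Fin n → Fin 3, if (∀ v, t' v = if v ∈ D then t v else 0) then
        (if U.card ≤ k ∧ t = (fun v => if v ∈ U then c v else 0) then (1 : ℤ) else 0) else 0 := by
  classical
  rw [Finset.sum_eq_single (fun v => if v ∈ U then c v else 0)]
  · have hD : D.card ≤ k := (Finset.card_le_card hDU).trans hU
    have hiff : (t' = fun v => if v ∈ D then c v else 0) ↔ ∀ v, t' v = if v ∈ D then (if v ∈ U then c v else 0) else 0 := by
      constructor
      · rintro rfl v
        by_cases hv : v ∈ D
        · simp [hv, hDU hv]
        · simp [hv]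
      · intro h
        funext v
        rw [h v]
        by_cases hv : v ∈ D
        · simp [hv, hDU hv]
        · simp [hv]
    by_cases h : t' = fun v => if v ∈ D then c v else 0
    · rw [if_pos ⟨hD, h⟩, if_pos (hiff.1 h), if_pos ⟨hU, rfl⟩]
    · rw [if_neg (fun h' => h h'.2), if_neg (fun h' => h (hiff.2 h'))]
  · intro t _ ht
    rw [if_neg (fun h' : U.card ≤ k ∧ t = _ => ht h'.2), ite_self]
  · intro h; exact absurd (Finset.mem_univ _) h

/-- **`LevelsSound` (stmt-PneNP-2542)**: a 3-colourable graph passes every level — genuine expectation at a proper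
colouring, restrictions of the colouring as the consistent family, indicator sections.
[cite: arXiv170104521, §2.3 (any distribution on solutions is a pseudoexpectation)] [folklore] -/
theorem descentTower_levelsSound_proof : Summit.PneNP.PneNP.Theses.DescentTower.LevelsSound := by
  classical
  intro n G hcol k
  obtain ⟨C⟩ := hcol
  -- the colouring, its restrictions, the indicator sections
  set c : Fin n → Fin 3 := fun v => C v with hc
  have hvalid : ∀ u v : Fin n, G.Adj u v → c u ≠ c v := fun u v h => C.valid h
  set cU : Finset (Fin n) → Fin n → Fin 3 := fun U v => if v ∈ U then c v else 0 with hcU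
  set r : Finset (Fin n) → (Fin n → Fin 3) → ℤ := fun U t => if U.card ≤ k ∧ t = cU U then 1 else 0 with hr
  have hmarg : ∀ U D : Finset (Fin n), D ⊆ U → U.card ≤ k → ∀ t' : Fin n → Fin 3,
      r D t' = ∑ t : Fin n → Fin 3, if (∀ v, t' v = if v ∈ D then t v else 0) then r U t else 0 :=
    fun U D hDU hU t' => descentTower_indicator_marginal k c U D hDU hU t'
  -- the 0/1 point of the colouring and the evaluation functional
  set pt : ℕ → ℝ := fun i => if h : i / 3 < n then (if ((c ⟨i / 3, h⟩ : Fin 3) : ℕ) = i % 3 then 1 else 0) else 0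
    with hpt
  have hpt01 : ∀ i, pt i = 0 ∨ pt i = 1 := by
    intro i; simp only [hpt]; split_ifs <;> simp
  have hptv : ∀ (v : Fin n) (a : Fin 3), pt (3 * v.val + a.val) = if c v = a then 1 else 0 := by
    intro v a
    have h1 : (3 * v.val + a.val) / 3 = v.val := by omega
    have h2 : (3 * v.val + a.val) % 3 = a.val := by omega
    simp only [hpt, h1, h2, v.isLt, dite_true, Fin.eta]
    by_cases h : c v = a
    · rw [if_pos h, if_pos (congrArg Fin.val h)]
    · rw [if_neg h, if_neg (fun h' => h (Fin.ext h'))]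
  set E : MvPolynomial ℕ ℝ →ₗ[ℝ] ℝ := (MvPolynomial.aeval pt).toLinearMap with hE
  have hEapp : ∀ p, E p = aeval pt p := fun _ => rfl
  have hEprod : ∀ (U : Finset (Fin n)) (t : Fin n → Fin 3),
      E (∏ v ∈ U, X (3 * v.val + (t v).val)) = ∏ v ∈ U, (if c v = t v then (1 : ℝ) else 0) := by
    intro U t
    rw [hEapp, map_prod]
    exact Finset.prod_congr rfl fun v _ => by rw [aeval_X, hptv]
  refine ⟨⟨E, ⟨by simp [hEapp], fun p _ => ?_⟩, fun i s _ => ?_, fun v s _ => ?_, fun u v huv a s _ => ?_, ?_⟩, ?_⟩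
  · rw [hEapp, map_mul]; exact mul_self_nonneg _
  · rw [hEapp, map_mul, Literature.Computability.MetaComplexity.boolAxiom, map_sub, map_pow, aeval_X]
    have : pt i ^ 2 - pt i = 0 := by rcases hpt01 i with h | h <;> rw [h] <;> norm_num
    rw [this, zero_mul]
  · rw [hEapp, map_mul, map_sub, map_one, map_sum]
    have : ∑ a : Fin 3, aeval pt (X (3 * v.val + a.val) : MvPolynomial ℕ ℝ) = 1 := by
      simp_rw [aeval_X, hptv]
      rw [Finset.sum_ite_eq]; simp
    rw [this, sub_self, zero_mul]
  · rw [hEapp, map_mul, map_mul, aeval_X, aeval_X, hptv, hptv]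
    have : (if c u = a then (1 : ℝ) else 0) * (if c v = a then 1 else 0) = 0 := by
      by_cases hu : c u = a
      · have hv : c v ≠ a := fun hv => hvalid u v huv (hu.trans hv.symm)
        rw [if_neg hv, mul_zero]
      · rw [if_neg hu, zero_mul]
    rw [this, zero_mul]
  · -- local consistency of the moments: positive products are restrictions of `c`
    rintro ⟨U, s⟩ hUk hs0 hpos
    have hsc : s = cU U := by
      funext v
      by_cases hv : v ∈ U
      · rw [hEprod] at hpos
        have hne := (Finset.prod_ne_zero_iff.1 hpos.ne') v hv
        simp only [hcU, if_pos hv]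
        by_contra h
        exact hne (if_neg (Ne.symm h))
      · simp only [hcU, if_neg hv]; exact hs0 v hv
    refine ⟨r, fun U' t ht => ?_, hmarg, ?_, fun t ht => ?_⟩
    · have h' : U'.card ≤ k ∧ t = cU U' := by
        by_contra h; exact ht (if_neg h)
      refine ⟨h'.1, fun v hv => by rw [h'.2]; simp [hcU, hv], ?_⟩
      rw [hEprod, h'.2]
      refine Finset.prod_pos fun v hv => ?_
      simp [hcU, hv]
    · simp only [hr]; rw [if_pos ⟨hUk, hsc⟩]
    · simp only [hr]; rw [if_neg (fun h => ht (h.2.trans hsc.symm))]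
  · -- the consistent family of restrictions of `c`
    refine ⟨{p | p.1.card ≤ k ∧ p.2 = cU p.1}, ⟨(∅, cU ∅), by simp⟩, ?_⟩
    rintro ⟨U, s⟩ hp
    simp only [Set.mem_setOf_eq] at hp ⊢
    obtain ⟨hUk, rfl⟩ := hp
    refine ⟨hUk, fun v hv => by simp [hcU, hv], fun u hu v hv huv => ?_, fun D hD => ⟨(card_le_card hD).trans hUk, ?_⟩,
      fun hlt x => ⟨cU (insert x U), ⟨?_, rfl⟩, fun v hv => ?_⟩, r, fun U' t ht => ?_, hmarg, ?_, fun t ht => ?_⟩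
    · simpa [hcU, hu, hv] using hvalid u v huv
    · funext v
      by_cases hv : v ∈ D
      · simp [hcU, hv, hD hv]
      · simp [hcU, hv]
    · exact (Finset.card_insert_le x U).trans (by simpa using hlt)
    · simp [hcU, hv]
    · by_contra h; exact ht (if_neg h)
    · show (if U.card ≤ k ∧ cU U = cU U then (1 : ℤ) else 0) = 1
      rw [if_pos ⟨hUk, rfl⟩]
    · show (if U.card ≤ k ∧ t = cU U then (1 : ℤ) else 0) = 0
      rw [if_neg (fun h => ht h.2)]

end Summit.PneNP.PneNP.Theorems
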